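import Summits.AnomalousDissipation.AnomalousDissipation.Theorems.NeutralTaylorWavesTaylorWaveQuasiSteadyHierarchy

/-!
# The ε-free hierarchy unfolded order by order (line `windfibred`, rev 3)
# (crux stmt-AnomalousDissipation-16293, `NeutralTaylorWaves.TaylorWaveQuasiSteady`)

The coefficient profiles `divCoeff … s`, `hierarchyCoeff … s` of `Theorems/…Hierarchy.lean` are written as sums over ALL
index pairs `a, b < N + 1` with indicators (the form in which the Laurent expansions are proved).  For READING the open
core `stub_hierarchyW` — and for attacking it at a fixed finite order — one wants the usual triangular (antidiagonal)
form.  This file provides it for every order `t` inside the truncation (`t ≤ N`, where no truncation effect occurs):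

* `divCoeff_succ`: `d_{t+1} = div_x P_t + k·∂_θ P_{t+1}` for `t + 1 ≤ N`, and `divCoeff_top`: `d_{N+1} = div_x P_N`;
* `hierarchyCoeff_of_le`: for `1 ≤ t ≤ N`,
  `M_t = ∑_{a<t} (P_a·∇_x)P_{t-1-a} + ∑_{a≤t} (P_a·k)∂_θP_{t-a} − [3 ≤ t] Δ_x P_{t-3}`
  `      − [2 ≤ t] ∑ᵢ(∂ᵢ(kᵢ∂_θ·) + kᵢ∂_θ∂ᵢ) P_{t-2} − |k|²∂_θ² P_{t-1} + ∇_x Q_{t-1} + k ∂_θ Q_t`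
  `      − ∑_{a<t} c_a ∂_{x₂} P_{t-1-a} − ∑_{a≤t} c_a k₂∂_θ P_{t-a} − [t = 1] f`
  (all sums over `Finset.range`, `P_{t-1-a}` with natural subtraction inside the stated ranges; second-order terms kept as
  the compositions `sDeriv i (sDeriv i ·)`, `sDeriv i (fDeriv j G i ·)`, `fDeriv j G i (sDeriv i ·)`, `fDeriv j G i (fDeriv j G i ·)`).
Together with `Eikonal.hierarchyCoeff_zero` / `Eikonal.divCoeff_zero` (order `0`) this spells out `stub_hierarchyW` at any
finite `N` as an explicit list of profile PDEs on `T⁴` (e.g. `N = 1`: eikonal order + the leading fast problem + `d_0, d_1, d_2`).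

Tools: two reindexing lemmas for indicator sums over `Finset.range (N + 1)` (`sum_ite_add_eq`, `sum_sum_ite_add_eq`).
Registered as the tools sub-stub `stub_hierarchyWUnfold` (last theorem). Pure algebra; [folklore].
-/

-- `Summit.<Summit>.<Problem>` is the tree's mandated summit-side namespace (CONVENTIONS §2); for this
-- single-conjunct summit the two coincide, so the duplicate is deliberate.
set_option linter.dupNamespace false

noncomputable section

open scoped BigOperators
open Literature.Analysis.FunctionSpaces Literature.Analysis.FunctionSpaces.Torus

namespace Summit.AnomalousDissipation.AnomalousDissipation.Theorems.TaylorWaveQuasiSteady.Unfold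

open Summit.AnomalousDissipation.AnomalousDissipation.Theorems.TaylorWaveQuasiSteady

/-! ## §1 Reindexing indicator sums over `Finset.range (N + 1)` -/

section Reindex

variable {M : Type*} [AddCommMonoid M]

/-- `∑_{a<N+1} [a + r = t] Y_a = Y_{t-r}` when `r ≤ t ≤ N + r` (the unique index `a = t - r` lies in the range). [folklore] -/
theorem sum_ite_add_eq (N r t : ℕ) (Y : ℕ → M) (hr : r ≤ t) (ht : t ≤ N + r) :
    (∑ a ∈ Finset.range (N + 1), if a + r = t then Y a else 0) = Y (t - r) := by
  have h : ∀ a ∈ Finset.range (N + 1), (if a + r = t then Y a else 0) = if a = t - r then Y a else 0 := by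
    intro a _
    by_cases ha : a + r = t
    · rw [if_pos ha, if_pos (by omega)]
    · rw [if_neg ha, if_neg (by omega)]
  rw [Finset.sum_congr rfl h, Finset.sum_ite_eq']
  rw [if_pos (Finset.mem_range.2 (by omega))]

/-- `∑_{a<N+1} [a + r = t] Y_a = 0` when `t < r`. [folklore] -/
theorem sum_ite_add_eq_zero (N r t : ℕ) (Y : ℕ → M) (hr : t < r) :
    (∑ a ∈ Finset.range (N + 1), if a + r = t then Y a else 0) = 0 :=
  Finset.sum_eq_zero fun a _ => if_neg (by omega)

/-- `∑_{a<N+1} ∑_{b<N+1} [a + b = t] X_{a,b} = ∑_{a<t+1} X_{a,t-a}` when `t ≤ N` (no truncation effect). [folklore] -/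
theorem sum_sum_ite_add_eq (N t : ℕ) (X : ℕ → ℕ → M) (ht : t ≤ N) :
    (∑ a ∈ Finset.range (N + 1), ∑ b ∈ Finset.range (N + 1), if a + b = t then X a b else 0) =
      ∑ a ∈ Finset.range (t + 1), X a (t - a) := by
  have hinner : ∀ a ∈ Finset.range (N + 1),
      (∑ b ∈ Finset.range (N + 1), if a + b = t then X a b else 0) = if a ≤ t then X a (t - a) else 0 := by
    intro a _
    by_cases hat : a ≤ t
    · rw [if_pos hat]
      have h : ∀ b ∈ Finset.range (N + 1), (if a + b = t then X a b else 0) = if b = t - a then X a b else 0 := by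
        intro b _
        by_cases hb : a + b = t
        · rw [if_pos hb, if_pos (by omega)]
        · rw [if_neg hb, if_neg (by omega)]
      rw [Finset.sum_congr rfl h, Finset.sum_ite_eq', if_pos (Finset.mem_range.2 (by omega))]
    · rw [if_neg hat]
      exact Finset.sum_eq_zero fun b _ => if_neg (by omega)
  rw [Finset.sum_congr rfl hinner, ← Finset.sum_filter]
  have hflt : (Finset.range (N + 1)).filter (fun a => a ≤ t) = Finset.range (t + 1) := by
    ext a
    simp only [Finset.mem_filter, Finset.mem_range]
    omega
  rw [hflt]

/-- The shifted two-index version: `∑_{a<N+1} ∑_{b<N+1} [a + b + 1 = t] X_{a,b} = ∑_{a<t} X_{a,t-1-a}` when `1 ≤ t ≤ N + 1`.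
[folklore] -/
theorem sum_sum_ite_add_succ_eq (N t : ℕ) (X : ℕ → ℕ → M) (ht1 : 1 ≤ t) (ht : t ≤ N + 1) :
    (∑ a ∈ Finset.range (N + 1), ∑ b ∈ Finset.range (N + 1), if a + b + 1 = t then X a b else 0) =
      ∑ a ∈ Finset.range t, X a (t - 1 - a) := by
  have h : ∀ a b : ℕ, (if a + b + 1 = t then X a b else 0) = if a + b = t - 1 then X a b else 0 := by
    intro a b
    by_cases hab : a + b + 1 = t
    · rw [if_pos hab, if_pos (by omega)]
    · rw [if_neg hab, if_neg (by omega)]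
  rw [Finset.sum_congr rfl fun a _ => Finset.sum_congr rfl fun b _ => h a b, sum_sum_ite_add_eq N (t - 1) X (by omega)]
  congr 1
  congr 1
  omega

/-- The shifted two-index version vanishes at `t = 0`. [folklore] -/
theorem sum_sum_ite_add_succ_eq_zero (N : ℕ) (X : ℕ → ℕ → M) :
    (∑ a ∈ Finset.range (N + 1), ∑ b ∈ Finset.range (N + 1), if a + b + 1 = 0 then X a b else 0) = 0 :=
  Finset.sum_eq_zero fun _ _ => Finset.sum_eq_zero fun _ _ => if_neg (Nat.succ_ne_zero _)

end Reindex

/-! ## §2 The formal divergence, unfolded -/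

variable (j : Fin 3 → ℤ) (G : UnitAddTorus (Fin 3) → ℝ) (f : UnitAddTorus (Fin 3) → EuclideanSpace ℝ (Fin 3)) (N : ℕ)
  (P : ℕ → UnitAddTorus (Fin 4) → EuclideanSpace ℝ (Fin 3)) (Q : ℕ → UnitAddTorus (Fin 4) → ℝ) (c : ℕ → ℝ)

/-- **`d_{t+1} = div_x P_t + k·∂_θ P_{t+1}`** for `t + 1 ≤ N`. [folklore] -/
theorem divCoeff_succ (t : ℕ) (ht : t + 1 ≤ N) (y : UnitAddTorus (Fin 4)) :
    divCoeff j G N P (t + 1) y =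
      (∑ i : Fin 3, (sDeriv i (P t) y) i) + ∑ i : Fin 3, (fDeriv j G i (P (t + 1)) y) i := by
  unfold divCoeff
  rw [Finset.sum_add_distrib, sum_ite_add_eq N 1 (t + 1) _ (by omega) (by omega)]
  have h2 := sum_ite_add_eq N 0 (t + 1) (fun a => ∑ i : Fin 3, (fDeriv j G i (P a) y) i) (Nat.zero_le _) (by omega)
  simp only [add_zero] at h2
  rw [h2]
  rfl

/-- **`d_{N+1} = div_x P_N`** (top order: the truncation itself must be slow-divergence-free at the last index). [folklore] -/
theorem divCoeff_top (y : UnitAddTorus (Fin 4)) :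
    divCoeff j G N P (N + 1) y = ∑ i : Fin 3, (sDeriv i (P N) y) i := by
  unfold divCoeff
  rw [Finset.sum_add_distrib, sum_ite_add_eq N 1 (N + 1) _ (by omega) (by omega)]
  have h2 : (∑ a ∈ Finset.range (N + 1), if a = N + 1 then ∑ i : Fin 3, (fDeriv j G i (P a) y) i else 0) = 0 :=
    Finset.sum_eq_zero fun a ha => if_neg (by have := Finset.mem_range.1 ha; omega)
  rw [h2, add_zero]
  rfl

/-! ## §3 The formal residual, unfolded for `1 ≤ t ≤ N` -/

/-- **The order-`t` equation of the hierarchy in triangular form** (`1 ≤ t ≤ N`; `M_t` = coefficient of `ε^{t-1}` of the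
two-scale steady residual on the polynomial ansatz):
slow convection `∑_{a<t} (P_a·∇_x)P_{t-1-a}`, fast convection `∑_{a≤t} (P_a·k)∂_θP_{t-a}`, viscosity
`−[3 ≤ t] Δ_xP_{t-3} − [2 ≤ t] (cross terms) P_{t-2} − |k|²∂_θ²P_{t-1}`, pressure `∇_xQ_{t-1} + k∂_θQ_t`, drift
`−∑_{a<t} c_a∂_{x₂}P_{t-1-a} − ∑_{a≤t} c_a k₂∂_θP_{t-a}`, force `−[t = 1] f`. [folklore] -/
theorem hierarchyCoeff_of_le (t : ℕ) (ht1 : 1 ≤ t) (ht : t ≤ N) (y : UnitAddTorus (Fin 4)) :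
    hierarchyCoeff j G f N P Q c t y =
      (∑ a ∈ Finset.range t, ∑ l : Fin 3, (P a y) l • sDeriv l (P (t - 1 - a)) y)
      + (∑ a ∈ Finset.range (t + 1), ∑ l : Fin 3, (P a y) l • fDeriv j G l (P (t - a)) y)
      - (if 3 ≤ t then ∑ i : Fin 3, sDeriv i (sDeriv i (P (t - 3))) y else 0)
      - (if 2 ≤ t then ∑ i : Fin 3, (sDeriv i (fDeriv j G i (P (t - 2))) y + fDeriv j G i (sDeriv i (P (t - 2))) y)
          else 0)
      - (∑ i : Fin 3, fDeriv j G i (fDeriv j G i (P (t - 1))) y)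
      + WithLp.toLp 2 (fun i : Fin 3 => sDeriv i (Q (t - 1)) y + fDeriv j G i (Q t) y)
      - (∑ a ∈ Finset.range t, c a • sDeriv 2 (P (t - 1 - a)) y)
      - (∑ a ∈ Finset.range (t + 1), c a • fDeriv j G 2 (P (t - a)) y)
      - (if t = 1 then f (slow y) else 0) := by
  -- convection
  have hconv : (∑ a ∈ Finset.range (N + 1), ∑ b ∈ Finset.range (N + 1),
      ((if a + b + 1 = t then ∑ l : Fin 3, (P a y) l • sDeriv l (P b) y else 0) +
        (if a + b = t then ∑ l : Fin 3, (P a y) l • fDeriv j G l (P b) y else 0))) =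
      (∑ a ∈ Finset.range t, ∑ l : Fin 3, (P a y) l • sDeriv l (P (t - 1 - a)) y)
        + ∑ a ∈ Finset.range (t + 1), ∑ l : Fin 3, (P a y) l • fDeriv j G l (P (t - a)) y := by
    simp only [Finset.sum_add_distrib]
    rw [sum_sum_ite_add_succ_eq N t _ ht1 (by omega), sum_sum_ite_add_eq N t _ ht]
  -- viscosity
  have hvisc : (∑ a ∈ Finset.range (N + 1),
      ((if a + 3 = t then ∑ i : Fin 3, sDeriv i (sDeriv i (P a)) y else 0) +
        (if a + 2 = t then ∑ i : Fin 3, (sDeriv i (fDeriv j G i (P a)) y + fDeriv j G i (sDeriv i (P a)) y)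
          else 0) +
        (if a + 1 = t then ∑ i : Fin 3, fDeriv j G i (fDeriv j G i (P a)) y else 0))) =
      (if 3 ≤ t then ∑ i : Fin 3, sDeriv i (sDeriv i (P (t - 3))) y else 0)
        + (if 2 ≤ t then ∑ i : Fin 3, (sDeriv i (fDeriv j G i (P (t - 2))) y + fDeriv j G i (sDeriv i (P (t - 2))) y)
            else 0)
        + ∑ i : Fin 3, fDeriv j G i (fDeriv j G i (P (t - 1))) y := by
    simp only [Finset.sum_add_distrib]
    congr 1
    · congr 1
      · by_cases h3 : 3 ≤ t
        · rw [if_pos h3, sum_ite_add_eq N 3 t _ h3 (by omega)]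
        · rw [if_neg h3, sum_ite_add_eq_zero N 3 t _ (by omega)]
      · by_cases h2 : 2 ≤ t
        · rw [if_pos h2, sum_ite_add_eq N 2 t _ h2 (by omega)]
        · rw [if_neg h2, sum_ite_add_eq_zero N 2 t _ (by omega)]
    · rw [sum_ite_add_eq N 1 t _ ht1 (by omega)]
  -- pressure
  have hpres : (∑ a ∈ Finset.range (N + 1),
      WithLp.toLp 2 (fun i : Fin 3 =>
        (if a + 1 = t then sDeriv i (Q a) y else 0) + (if a = t then fDeriv j G i (Q a) y else 0))) =
      WithLp.toLp 2 (fun i : Fin 3 => sDeriv i (Q (t - 1)) y + fDeriv j G i (Q t) y) := by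
    ext i
    simp only [WithLp.ofLp_sum, Finset.sum_apply, Finset.sum_add_distrib]
    rw [sum_ite_add_eq N 1 t (fun a => sDeriv i (Q a) y) ht1 (by omega)]
    have h2 := sum_ite_add_eq N 0 t (fun a => fDeriv j G i (Q a) y) (Nat.zero_le _) (by omega)
    simp only [add_zero, Nat.sub_zero] at h2
    rw [h2]
  -- drift
  have hdrift : (∑ a ∈ Finset.range (N + 1), ∑ b ∈ Finset.range (N + 1),
      ((if a + b + 1 = t then c a • sDeriv 2 (P b) y else 0) +
        (if a + b = t then c a • fDeriv j G 2 (P b) y else 0))) =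
      (∑ a ∈ Finset.range t, c a • sDeriv 2 (P (t - 1 - a)) y)
        + ∑ a ∈ Finset.range (t + 1), c a • fDeriv j G 2 (P (t - a)) y := by
    simp only [Finset.sum_add_distrib]
    rw [sum_sum_ite_add_succ_eq N t _ ht1 (by omega), sum_sum_ite_add_eq N t _ ht]
  unfold hierarchyCoeff
  rw [hconv, hvisc, hpres, hdrift]
  abel

/-! ## §4 The registered tools sub-stub -/

/-- **stub_hierarchyWUnfold** (registered tools sub-stub of stmt-AnomalousDissipation-16293; conjunction of the unfolding
lemmas of this file): `divCoeff_succ`, `divCoeff_top`, `hierarchyCoeff_of_le`. [folklore] -/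
theorem stub_hierarchyWUnfold : (∀ (j : Fin 3 → ℤ) (G : UnitAddTorus (Fin 3) → ℝ) (N : ℕ) (P : ℕ → UnitAddTorus (Fin 4) → EuclideanSpace ℝ (Fin 3)) (t : ℕ), t + 1 ≤ N → ∀ y : UnitAddTorus (Fin 4), divCoeff j G N P (t + 1) y = (∑ i : Fin 3, (sDeriv i (P t) y) i) + ∑ i : Fin 3, (fDeriv j G i (P (t + 1)) y) i) ∧ (∀ (j : Fin 3 → ℤ) (G : UnitAddTorus (Fin 3) → ℝ) (N : ℕ) (P : ℕ → UnitAddTorus (Fin 4) → EuclideanSpace ℝ (Fin 3)) (y : UnitAddTorus (Fin 4)), divCoeff j G N P (N + 1) y = ∑ i : Fin 3, (sDeriv i (P N) y) i) ∧ (∀ (j : Fin 3 → ℤ) (G : UnitAddTorus (Fin 3) → ℝ) (f : UnitAddTorus (Fin 3) → EuclideanSpace ℝ (Fin 3)) (N : ℕ) (P : ℕ → UnitAddTorus (Fin 4) → EuclideanSpace ℝ (Fin 3)) (Q : ℕ → UnitAddTorus (Fin 4) → ℝ) (c : ℕ → ℝ) (t : ℕ), 1 ≤ t → t ≤ N → ∀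 y : UnitAddTorus (Fin 4), hierarchyCoeff j G f N P Q c t y = (∑ a ∈ Finset.range t, ∑ l : Fin 3, (P a y) l • sDeriv l (P (t - 1 - a)) y) + (∑ a ∈ Finset.range (t + 1), ∑ l : Fin 3, (P a y) l • fDeriv j G l (P (t - a)) y) - (if 3 ≤ t then ∑ i : Fin 3, sDeriv i (sDeriv i (P (t - 3))) y else 0) - (if 2 ≤ t then ∑ i : Fin 3, (sDeriv i (fDeriv j G i (P (t - 2))) y + fDeriv j G i (sDeriv i (P (t - 2))) y) else 0) - (∑ i : Fin 3, fDeriv j G i (fDeriv j G i (P (t - 1))) y) + WithLp.toLp 2 (fun i : Fin 3 => sDeriv i (Q (t - 1)) y + fDeriv j G i (Q t) y) - (∑ a ∈ Finset.range t, c a • sDeriv 2 (P (t - 1 - a)) y) - (∑ a ∈ Finset.range (t + 1), c a • fDeriv j G 2 (P (t - a)) y) - (if t = 1 then f (slow y) else 0)) :=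
  ⟨fun j G N P t ht y => divCoeff_succ j G N P t ht y, fun j G N P y => divCoeff_top j G N P y,
    fun j G f N P Q c t ht1 ht y => hierarchyCoeff_of_le j G f N P Q c t ht1 ht y⟩

end Summit.AnomalousDissipation.AnomalousDissipation.Theorems.TaylorWaveQuasiSteady.Unfold

end
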